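import Literature.NumberTheory.EllipticCurves.LatticeKroneckerLimit
import Literature.NumberTheory.LFunctions.BinaryThetaLValueOne
import HarnessLib

/-!
# Kronecker's limit formula of weight one on the lattices `ℤ√-N + ℤ`, and the Eisenstein numbers
# `E₁(z; L)` at division points as weight-one theta `L`-values at `s = 1`

Topic `Literature/NumberTheory/EllipticCurves` (complex-lattice cluster). For `N ≥ 1` let
`τ_N = √N · i ∈ ℍ` and `Λ_N = ℤ τ_N + ℤ` (`BinaryLattice.periodPair N`, the lattice whose norm
form is the binary form `y₁² + N y₂²` of `Literature.NumberTheory.LFunctions.BinaryThetaSeries`;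
for the nine imaginary quadratic fields of class number one, `𝓞_K` is `Λ_N` (`d_K = -4, -8`) or
contains `Λ_{|d_K|}` with index `2`). We discharge the two hypotheses of the abstract Kronecker
limit formula `PeriodPair.tendsto_kroneckerSum_of_tendsto₂` (`LatticeKroneckerLimit`) for `Λ_N`:

* `BinaryLattice.tendsto_mul_gaussN` — `y ∑_{l ∈ Λ_N} e^{-y|l|²} → π/√N` (the Gaussian sum
  factors into two Jacobi theta functions, `θ(y/π) θ(Ny/π)`, and `√x θ(x) → 1`);
* `BinaryLattice.tendsto_kroneckerSum_divPoint` — at every division point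
  `z = (c₁ + c₂ τ_N)/M` the damped sum `K_y(z) = ∑_l e^{-y|z-l|²}/(z-l)` converges as `y → 0⁺`,
  namely to `M · L_c(1)`, `L_c = BinaryTheta.thetaLFunction N M 1 (-τ_N) 𝟙_c` the entire
  continuation of the class Dirichlet series `∑_{y ≡ c (M)} (y₁ - y₂ τ_N) (y₁² + N y₂²)^{-s}`
  (`BinaryThetaLValueOne.tendsto_tsum_thetaLFunction_one`: the class of `c` inside `M⁻¹ ℤ²` is
  `{M(z - l)}`, and `(y₁ - y₂τ)/(y₁² + Ny₂²) = 1/(y₁ + y₂τ)`),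

and conclude:

* `BinaryLattice.tendsto_kroneckerSum` — **for every `z ∈ ℂ`,
  `lim_{y → 0⁺} ∑_{l ∈ Λ_N} e^{-y|z-l|²}/(z - l) = ζ(z; Λ_N) - η(z; Λ_N)`** (Rubin, LNM 1716,
  Prop. 7.12 at `k = 1`: `E₁ = (log σ)' - s₂ z - A⁻¹ z̄`, `η = quasiPeriodMap`);
* `BinaryLattice.thetaLFunction_classInd_one` — **the Eisenstein number at a division point is a
  partial Hecke value at `s = 1`**: `M · L_c(1) = E₁((c₁ + c₂ τ_N)/M; Λ_N)` with
  `E₁(z; L) = ζ(z; L) - η(z; L)` (`PeriodPair.eisensteinE₁`) — Rubin's Prop. 7.15 at `k = 1`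
  (`E₁(v; L) = v⁻¹ ψ(𝔠) L_𝔪(ψ̄, 1, 𝔠)`) in the character-free form: the left side is the value at
  `s = 1` of the continuation of `∑_{β ∈ Mz + MΛ} β̄ |β|^{-2s}`, times `M`;
* `BinaryLattice.thetaLFunction_one_eq_sum_eisensteinE₁` — for any coefficient `Ψ` periodic
  modulo `M`: `thetaLFunction N M 1 (-τ_N) Ψ 1 = M⁻¹ ∑_{c mod M} Ψ(c) E₁((c₁ + c₂τ_N)/M; Λ_N)`,
  the finite formula expressing weight-one Hecke `L`-values of `ℚ(√-N)`-type theta series at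
  `s = 1` through Eisenstein numbers (for `N = 1`:
  `GaussianLatticeHeckeLValue.thetaLFunction_one_eq_sum_kroneckerE₁`).

Everything is proved; the only definitions are `BinaryLattice.tau/periodPair/divPoint/classInd/
negLatt` and `PeriodPair.eisensteinE₁` (all with bodies).

## References

* K. Rubin, *Elliptic curves with complex multiplication and the conjecture of Birch and
  Swinnerton-Dyer*, LNM 1716 (1999), §7.4: Def. 7.9, Def. 7.11, Prop. 7.12, Prop. 7.15 (held:
  `book:coates1999-arithmetic-theory-elliptic-curves`, pp. 244–245). [Rubin1999]
* A. Weil, *Elliptic Functions according to Eisenstein and Kronecker*, Springer 1976, Ch. VIII.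
-/

noncomputable section

open Complex Real Filter Topology Asymptotics PeriodPair HurwitzZeta
open Literature.NumberTheory.EllipticCurves.GaussianLattice
open Literature.NumberTheory.LFunctions Literature.NumberTheory.LFunctions.BinaryTheta
open scoped ComplexConjugate

namespace PeriodPair

/-- **The Eisenstein number of weight one** `E₁(z; L) = ζ(z; L) - η(z; L)` of a lattice, with
`ζ` the Weierstrass zeta function and `η = L.quasiPeriodMap` the `ℝ`-linear quasi-period map
(Rubin, LNM 1716, Prop. 7.12: `E₁(z; L) = (log σ(z; L))' - s₂(L) z - A(L)⁻¹ z̄`, his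
`η(z; L) = s₂(L) z + A(L)⁻¹ z̄` of Def. 7.9 being `L.quasiPeriodMap`; deliberate dot-notation
extension of Mathlib's `PeriodPair`). [cite: Rubin1999, §7.4 Def. 7.11 and Prop. 7.12] -/
def eisensteinE₁ (L : PeriodPair) (z : ℂ) : ℂ := L.weierstrassZeta z - L.quasiPeriodMap z

/-- Unfolding lemma for `eisensteinE₁`. [folklore] -/
theorem eisensteinE₁_def (L : PeriodPair) (z : ℂ) :
    L.eisensteinE₁ z = L.weierstrassZeta z - L.quasiPeriodMap z := rfl

end PeriodPair

namespace Literature.NumberTheory.EllipticCurves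

namespace BinaryLattice

variable (N : ℕ) [NeZero N]

/-! ### The lattice `Λ_N = ℤ√-N + ℤ` -/

/-- `0 < √N` for `N ≥ 1`. [folklore] -/
theorem sqrt_pos : 0 < Real.sqrt N :=
  Real.sqrt_pos.mpr (Nat.cast_pos.mpr (Nat.pos_of_ne_zero (NeZero.ne N)))

/-- The point `τ_N = √N · i` of the upper half-plane. [folklore] -/
def tau : UpperHalfPlane :=
  ⟨(Real.sqrt N : ℂ) * I, by simpa using sqrt_pos N⟩

/-- `τ_N = √N i` as a complex number. [folklore] -/
@[simp] theorem coe_tau : ((tau N : UpperHalfPlane) : ℂ) = (Real.sqrt N : ℂ) * I := rfl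

omit [NeZero N] in
/-- `τ_N² = -N`. [folklore] -/
theorem tau_sq : ((Real.sqrt N : ℂ) * I) ^ 2 = -(N : ℂ) := by
  have h : ((Real.sqrt N : ℝ) : ℂ) ^ 2 = (N : ℂ) := by
    rw [← Complex.ofReal_pow, Real.sq_sqrt (Nat.cast_nonneg N)]
    push_cast
    rfl
  rw [mul_pow, I_sq, h]
  ring

omit [NeZero N] in
/-- `conj τ_N = -τ_N`. [folklore] -/
theorem conj_tau : conj ((Real.sqrt N : ℂ) * I) = -((Real.sqrt N : ℂ) * I) := by
  rw [map_mul, Complex.conj_ofReal, Complex.conj_I]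
  ring

/-- The period pair `(τ_N, 1)`, lattice `Λ_N = ℤ τ_N + ℤ = ℤ√-N + ℤ`. [folklore] -/
def periodPair : PeriodPair := PeriodPair.ofUpperHalfPlane (tau N)

/-- The points of `Λ_N` through Mathlib's `latticeEquivProd`: `(m, n) ↦ m τ_N + n`. [folklore] -/
theorem coe_latticeEquivProd_symm (p : ℤ × ℤ) :
    (((periodPair N).latticeEquivProd.symm p : (periodPair N).lattice) : ℂ) =
      (p.1 : ℂ) * ((Real.sqrt N : ℂ) * I) + p.2 := by
  rw [latticeEquiv_symm_apply]
  simp [periodPair]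

omit [NeZero N] in
/-- `|m τ_N + n|² = n² + N m²`. [folklore] -/
theorem norm_sq_intCast_mul_tau_add (m n : ℤ) :
    ‖(m : ℂ) * ((Real.sqrt N : ℂ) * I) + n‖ ^ 2 = (n : ℝ) ^ 2 + N * (m : ℝ) ^ 2 := by
  rw [Complex.sq_norm, Complex.normSq_apply]
  simp
  nlinarith [Real.sq_sqrt (Nat.cast_nonneg (α := ℝ) N)]

/-- `‖l‖² = n² + N m²` for `l = m τ_N + n ∈ Λ_N`. [folklore] -/
theorem norm_sq_eq_of_lattice (l : (periodPair N).lattice) :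
    ‖(l : ℂ)‖ ^ 2 = (((periodPair N).latticeEquivProd l).2 : ℝ) ^ 2 +
      N * (((periodPair N).latticeEquivProd l).1 : ℝ) ^ 2 := by
  conv_lhs => rw [← (periodPair N).latticeEquivProd.symm_apply_apply l]
  rw [coe_latticeEquivProd_symm, norm_sq_intCast_mul_tau_add]

/-! ### The Gaussian sum: `y ∑_{l ∈ Λ_N} e^{-y|l|²} → π/√N` -/

/-- **`∑_{l ∈ Λ_N} e^{-y|l|²} = θ(y/π) θ(Ny/π)`** (`θ = evenKernel 0`), `y > 0`. [folklore] -/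
theorem hasSum_lattice_exp_neg_mul_norm_sq {y : ℝ} (hy : 0 < y) :
    HasSum (fun l : (periodPair N).lattice ↦ rexp (-y * ‖(l : ℂ)‖ ^ 2))
      (evenKernel ((0 : ℝ) : UnitAddCircle) (N * y / π) *
        evenKernel ((0 : ℝ) : UnitAddCircle) (y / π)) := by
  have hN : (0 : ℝ) < N := Nat.cast_pos.mpr (Nat.pos_of_ne_zero (NeZero.ne N))
  have h1 := hasSum_exp_neg_mul_sq (mul_pos hN hy)
  have h2 := hasSum_exp_neg_mul_sq hy
  have hs1 : Summable fun m : ℤ ↦ ‖rexp (-(N * y) * (m : ℝ) ^ 2)‖ := by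
    simpa only [Real.norm_eq_abs, abs_of_pos (Real.exp_pos _)] using h1.summable
  have hs2 : Summable fun m : ℤ ↦ ‖rexp (-y * (m : ℝ) ^ 2)‖ := by
    simpa only [Real.norm_eq_abs, abs_of_pos (Real.exp_pos _)] using h2.summable
  have hprod := h1.mul h2 (summable_mul_of_summable_norm hs1 hs2)
  have h3 := ((periodPair N).latticeEquivProd.toEquiv.hasSum_iff
    (f := fun p : ℤ × ℤ ↦ rexp (-(N * y) * (p.1 : ℝ) ^ 2) * rexp (-y * (p.2 : ℝ) ^ 2))).mpr hprod
  refine h3.congr_fun fun l ↦ ?_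
  simp only [Function.comp_apply, LinearEquiv.coe_toEquiv, ← Real.exp_add]
  congr 1
  rw [norm_sq_eq_of_lattice N l]
  ring

/-- The Gaussian sum of `Λ_N` in closed form: `N(y) = θ(Ny/π) θ(y/π)`. [folklore] -/
theorem gaussN_eq {y : ℝ} (hy : 0 < y) :
    (periodPair N).gaussN y =
      evenKernel ((0 : ℝ) : UnitAddCircle) (N * y / π) * evenKernel ((0 : ℝ) : UnitAddCircle) (y / π) :=
  (hasSum_lattice_exp_neg_mul_norm_sq N hy).tsum_eq

/-- **`y ∑_{l ∈ Λ_N} e^{-y|l|²} → π/√N`** as `y → 0⁺` (`covol(Λ_N) = √N`; Jacobi's `√x θ(x) → 1`).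
[folklore] -/
theorem tendsto_mul_gaussN :
    Tendsto (fun y : ℝ ↦ y * (periodPair N).gaussN y) (𝓝[>] 0) (𝓝 (π / Real.sqrt N)) := by
  have hN : (0 : ℝ) < N := Nat.cast_pos.mpr (Nat.pos_of_ne_zero (NeZero.ne N))
  have hsN := sqrt_pos N
  have hA : Tendsto (fun y : ℝ ↦ Real.sqrt (N * y / π) *
      evenKernel ((0 : ℝ) : UnitAddCircle) (N * y / π)) (𝓝[>] 0) (𝓝 1) := by
    refine tendsto_sqrt_mul_evenKernel_zero.comp ?_
    have h := GaussianTheta.tendsto_const_mul_nhdsGT_zero (c := (N : ℝ) / π) (by positivity)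
    refine h.congr fun y ↦ ?_
    ring
  have hB : Tendsto (fun y : ℝ ↦ Real.sqrt (y / π) *
      evenKernel ((0 : ℝ) : UnitAddCircle) (y / π)) (𝓝[>] 0) (𝓝 1) :=
    tendsto_sqrt_mul_evenKernel_zero.comp (tendsto_div_const_nhdsGT_zero Real.pi_pos)
  have h := (hA.mul hB).const_mul (π / Real.sqrt N)
  rw [mul_one, mul_one] at h
  refine h.congr' ?_
  filter_upwards [self_mem_nhdsWithin] with y (hy : 0 < y)
  rw [gaussN_eq N hy]
  have e1 : Real.sqrt (N * y / π) = Real.sqrt N * Real.sqrt (y / π) := by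
    rw [mul_div_assoc, Real.sqrt_mul (Nat.cast_nonneg N)]
  rw [e1]
  have e2 : Real.sqrt (y / π) * Real.sqrt (y / π) = y / π := Real.mul_self_sqrt (by positivity)
  set s := Real.sqrt (y / π) with hs
  set A := evenKernel ((0 : ℝ) : UnitAddCircle) (N * y / π) with hA'
  set B := evenKernel ((0 : ℝ) : UnitAddCircle) (y / π) with hB'
  have hπ : π ≠ 0 := Real.pi_ne_zero
  calc π / Real.sqrt N * (Real.sqrt N * s * A * (s * B))
      = π / Real.sqrt N * Real.sqrt N * (s * s) * (A * B) := by ring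
    _ = π * (y / π) * (A * B) := by rw [e2, div_mul_cancel₀ π hsN.ne']
    _ = y * (A * B) := by rw [mul_div_cancel₀ y hπ]

/-- The bound `y N(y) ≤ π/√N + 1` near `0⁺` (hypothesis `hB` of the abstract limit formula).
[folklore] -/
theorem gaussN_bound :
    ∃ C : ℝ, ∀ᶠ y : ℝ in 𝓝[>] 0, y * (periodPair N).gaussN y ≤ C :=
  ⟨π / Real.sqrt N + 1, (tendsto_mul_gaussN N).eventually (Iic_mem_nhds (by linarith))⟩

/-! ### Division points and the classes of `ℤ²` modulo `M` -/

variable (M : ℕ) [NeZero M]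

/-- The division point `(c₁ + c₂ τ_N)/M` of the class `c` modulo `M` (canonical representatives
`0 ≤ c₁, c₂ < M`). [folklore] -/
def divPoint (c : ZMod M × ZMod M) : ℂ :=
  (((c.1.val : ℤ) : ℂ) + ((c.2.val : ℤ) : ℂ) * ((Real.sqrt N : ℂ) * I)) / M

/-- The indicator of the class `c` modulo `M` on `ℤ × ℤ`. [folklore] -/
def classInd (c : ZMod M × ZMod M) (y : ℤ × ℤ) : ℂ := if cls M y = c then 1 else 0

omit [NeZero N] [NeZero M] in
/-- The class indicator is periodic modulo `M`. [folklore] -/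
theorem classInd_periodic (c : ZMod M × ZMod M) (y z : ℤ × ℤ) :
    classInd M c (y.1 + M * z.1, y.2 + M * z.2) = classInd M c y := by
  unfold classInd cls
  congr 2
  push_cast
  simp

/-- The bijection `ℤ × ℤ ≃ Λ_N`, `w ↦ -(w.1 + w.2 τ_N)`, matching `rep M c w = M (z_c - l)`.
[folklore] -/
def negLatt : ℤ × ℤ ≃ (periodPair N).lattice :=
  ((Equiv.neg (ℤ × ℤ)).trans (Equiv.prodComm ℤ ℤ)).trans (periodPair N).latticeEquivProd.symm.toEquiv

/-- `negLatt w = -(w.1 + w.2 τ_N)` as a complex number. [folklore] -/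
theorem coe_negLatt (w : ℤ × ℤ) :
    ((negLatt N w : (periodPair N).lattice) : ℂ) = -((w.1 : ℂ) + (w.2 : ℂ) * ((Real.sqrt N : ℂ) * I)) := by
  simp only [negLatt, Equiv.trans_apply, Equiv.neg_apply, Equiv.prodComm_apply, Prod.swap,
    Prod.fst_neg, Prod.snd_neg, LinearEquiv.coe_toEquiv]
  rw [show ((periodPair N).latticeEquivProd.symm (-w.2, -w.1) : ℂ) =
    ((((periodPair N).latticeEquivProd.symm (-w.2, -w.1)) : (periodPair N).lattice) : ℂ) from rfl,
    coe_latticeEquivProd_symm]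
  push_cast
  ring

/-- **The class of `c` is `{M(z_c - l) : l ∈ Λ_N}`**: `(rep M c w)₁ + (rep M c w)₂ τ_N =
M (divPoint c - negLatt w)`. [folklore] -/
theorem rep_eq_mul_sub (c : ZMod M × ZMod M) (w : ℤ × ℤ) :
    (((rep M c w).1 : ℤ) : ℂ) + (((rep M c w).2 : ℤ) : ℂ) * ((Real.sqrt N : ℂ) * I) =
      M * (divPoint N M c - (negLatt N w : (periodPair N).lattice)) := by
  have hM : (M : ℂ) ≠ 0 := Nat.cast_ne_zero.mpr (NeZero.ne M)
  rw [coe_negLatt, divPoint, rep_fst, rep_snd]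
  push_cast
  field_simp
  ring

omit [NeZero N] in
/-- `w(y)/Q(y) = 1/(y₁ + y₂ τ_N)` for the weights `u = 1`, `v = -τ_N` (`y₁ - y₂τ = conj(y₁ + y₂τ)`
and `Q = |y₁ + y₂τ|²`). [folklore] -/
theorem wt_div_qf_eq_inv (y : ℤ × ℤ) :
    wt 1 (-((Real.sqrt N : ℂ) * I)) y / ((qf N y : ℤ) : ℂ) =
      ((y.1 : ℂ) + (y.2 : ℂ) * ((Real.sqrt N : ℂ) * I))⁻¹ := by
  set w : ℂ := (y.1 : ℂ) + (y.2 : ℂ) * ((Real.sqrt N : ℂ) * I) with hw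
  have hconj : wt 1 (-((Real.sqrt N : ℂ) * I)) y = conj w := by
    rw [hw, wt, map_add, map_mul, map_intCast, map_intCast, conj_tau]
    ring
  have hQ : ((qf N y : ℤ) : ℂ) = (Complex.normSq w : ℂ) := by
    have h1 : (((qf N y : ℤ) : ℝ) : ℂ) = ((Complex.normSq w : ℝ) : ℂ) := by
      congr 1
      rw [qf_real, Complex.normSq_eq_norm_sq, hw]
      have := norm_sq_intCast_mul_tau_add N y.2 y.1
      rw [show (y.2 : ℂ) * ((Real.sqrt N : ℂ) * I) + y.1 = (y.1 : ℂ) + (y.2 : ℂ) * ((Real.sqrt N : ℂ) * I)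
        by ring] at this
      rw [this]
    exact_mod_cast h1
  rw [hconj, hQ, Complex.inv_def, div_eq_mul_inv, Complex.ofReal_inv]

/-! ### The damped class sums are damped lattice sums centred at the division point -/

/-- The summand of the damped sum of `BinaryThetaLValueOne.tendsto_tsum_thetaLFunction_one` for the
class indicator and the weights `(1, -τ_N)`. [folklore] -/
def dampedTerm (c : ZMod M × ZMod M) (t : ℝ) (y : ℤ × ℤ) : ℂ :=
  classInd M c y * wt 1 (-((Real.sqrt N : ℂ) * I)) y / ((qf N y : ℤ) : ℂ) *
    ((rexp (-t * ((qf N y : ℤ) : ℝ)) : ℝ) : ℂ)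

/-- **On the class, the damped term is the Kronecker summand**: with `l = negLatt w`, `z = divPoint c`,
`dampedTerm c t (rep M c w) = M⁻¹ · e^{-tM²|z - l|²}/(z - l)`. [folklore] -/
theorem dampedTerm_rep (c : ZMod M × ZMod M) (t : ℝ) (w : ℤ × ℤ) :
    dampedTerm N M c t (rep M c w) = (M : ℂ)⁻¹ *
      ((rexp (-(M ^ 2 * t) * ‖divPoint N M c - (negLatt N w : (periodPair N).lattice)‖ ^ 2) : ℂ) /
        (divPoint N M c - (negLatt N w : (periodPair N).lattice))) := by
  have hM : (M : ℂ) ≠ 0 := Nat.cast_ne_zero.mpr (NeZero.ne M)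
  set u : ℂ := divPoint N M c - (negLatt N w : (periodPair N).lattice) with hu
  have hx : (((rep M c w).1 : ℤ) : ℂ) + (((rep M c w).2 : ℤ) : ℂ) * ((Real.sqrt N : ℂ) * I) = M * u :=
    rep_eq_mul_sub N M c w
  have hQ : (((qf N (rep M c w) : ℤ) : ℝ)) = (M : ℝ) ^ 2 * ‖u‖ ^ 2 := by
    rw [qf_real]
    have := norm_sq_intCast_mul_tau_add N (rep M c w).2 (rep M c w).1
    rw [show ((rep M c w).2 : ℂ) * ((Real.sqrt N : ℂ) * I) + (rep M c w).1 =
      (((rep M c w).1 : ℤ) : ℂ) + (((rep M c w).2 : ℤ) : ℂ) * ((Real.sqrt N : ℂ) * I) by ring, hx,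
      norm_mul, Complex.norm_natCast] at this
    rw [← this]
    ring
  have hind : classInd M c (rep M c w) = 1 := by simp [classInd, cls_rep]
  rw [dampedTerm, hind, one_mul, wt_div_qf_eq_inv, hx, hQ, mul_inv]
  have he : rexp (-t * ((M : ℝ) ^ 2 * ‖u‖ ^ 2)) = rexp (-((M : ℝ) ^ 2 * t) * ‖u‖ ^ 2) := by
    congr 1; ring
  rw [he, div_eq_mul_inv]
  push_cast
  ring

/-- **The damped class sum is the damped lattice sum**: for `t > 0`,
`∑_{y ∈ ℤ²} dampedTerm c t y = M⁻¹ K_{M²t}(divPoint c)`. [folklore] -/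
theorem tsum_dampedTerm_eq (c : ZMod M × ZMod M) {t : ℝ} (ht : 0 < t) :
    ∑' y : ℤ × ℤ, dampedTerm N M c t y =
      (M : ℂ)⁻¹ * (periodPair N).kroneckerSum (M ^ 2 * t) (divPoint N M c) := by
  classical
  set z : ℂ := divPoint N M c with hz
  set G : (periodPair N).lattice → ℂ := fun l ↦
    (rexp (-(M ^ 2 * t) * ‖z - (l : ℂ)‖ ^ 2) : ℂ) / (z - l) with hG
  -- summability of the Kronecker family (Gaussian domination, bounded `1/(z-l)` off `z`)
  have hM0 : (0 : ℝ) < M := by exact_mod_cast Nat.pos_of_ne_zero (NeZero.ne M)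
  have hy : 0 < (M : ℝ) ^ 2 * t := by positivity
  have hsumG : Summable G := by
    obtain ⟨r, hr, -, hrl⟩ := (periodPair N).exists_pos_forall_le_norm
    -- `|z - l| ≥ ρ > 0` for `l ≠ z`: finitely many `l` with `|z - l| < 1`
    have hfin : {l : (periodPair N).lattice | ‖z - (l : ℂ)‖ < 1}.Finite := by
      have hsub : {l : (periodPair N).lattice | ‖z - (l : ℂ)‖ < 1} ⊆
          Metric.closedBall (0 : (periodPair N).lattice) (‖z‖ + 1) := by
        intro l hl
        rw [Set.mem_setOf_eq] at hl
        rw [Metric.mem_closedBall, dist_zero_right, show ‖l‖ = ‖(l : ℂ)‖ from rfl]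
        calc ‖(l : ℂ)‖ = ‖z - (z - l)‖ := by ring_nf
          _ ≤ ‖z‖ + ‖z - (l : ℂ)‖ := norm_sub_le _ _
          _ ≤ ‖z‖ + 1 := by linarith
      exact (isCompact_iff_finite.mp (isCompact_closedBall _ _)).subset hsub
    refine Summable.of_norm_bounded_eventually
      (((periodPair N).summable_exp_neg_mul_norm_sq (by positivity : 0 < (M : ℝ) ^ 2 * t / 2)).mul_left
        (rexp ((M : ℝ) ^ 2 * t * ‖z‖ ^ 2))) ?_
    refine Filter.mem_of_superset hfin.compl_mem_cofinite fun l hl ↦ ?_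
    rw [Set.mem_compl_iff, Set.mem_setOf_eq, not_lt] at hl
    rw [Set.mem_setOf_eq, hG]
    simp only
    rw [norm_div, Complex.norm_real, Real.norm_eq_abs, abs_of_pos (Real.exp_pos _)]
    calc rexp (-(↑M ^ 2 * t) * ‖z - ↑l‖ ^ 2) / ‖z - ↑l‖
        ≤ rexp (-(↑M ^ 2 * t) * ‖z - ↑l‖ ^ 2) := div_le_self (Real.exp_pos _).le hl
      _ ≤ rexp ((M : ℝ) ^ 2 * t * ‖z‖ ^ 2) * rexp (-((M : ℝ) ^ 2 * t / 2) * ‖(l : ℂ)‖ ^ 2) :=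
          exp_neg_mul_norm_sub_sq_le hy.le z l
  -- split the damped sum over the class of `c` (its support)
  have hoff : ∀ y ∉ Set.range (rep M c), dampedTerm N M c t y = 0 := by
    intro y hy'
    rw [range_rep] at hy'
    have hy'' : ¬ cls M y = c := hy'
    simp [dampedTerm, classInd, hy'']
  have hcomp : (fun y ↦ dampedTerm N M c t y) ∘ rep M c = fun w ↦ (M : ℂ)⁻¹ * G (negLatt N w) := by
    funext w
    exact dampedTerm_rep N M c t w
  have h1 : HasSum (fun w : ℤ × ℤ ↦ (M : ℂ)⁻¹ * G (negLatt N w)) ((M : ℂ)⁻¹ * ∑' l, G l) := by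
    have h5 : HasSum (G ∘ negLatt N) (∑' l, G l) := ((negLatt N).hasSum_iff).mpr hsumG.hasSum
    exact h5.mul_left _
  rw [← hcomp] at h1
  have h2 := ((rep_injective M c).hasSum_iff hoff).mp h1
  rw [h2.tsum_eq]
  rfl

/-- **The damped Kronecker sum converges at every division point**: for `z = (c₁ + c₂τ_N)/M`,
`K_y(z) → M · thetaLFunction N M 1 (-τ_N) 𝟙_c 1` as `y → 0⁺` (the theta continuation
`BinaryThetaLValueOne.tendsto_tsum_thetaLFunction_one`, after `y = M² t`). [folklore] -/
theorem tendsto_kroneckerSum_divPoint (c : ZMod M × ZMod M) :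
    Tendsto (fun y : ℝ ↦ (periodPair N).kroneckerSum y (divPoint N M c)) (𝓝[>] 0)
      (𝓝 ((M : ℂ) * thetaLFunction N M 1 (-((Real.sqrt N : ℂ) * I)) (classInd M c) 1)) := by
  have hM : (0 : ℝ) < M := by exact_mod_cast Nat.pos_of_ne_zero (NeZero.ne M)
  have hMc : (M : ℂ) ≠ 0 := Nat.cast_ne_zero.mpr (NeZero.ne M)
  -- the damped class sums tend to the `L`-value
  have hL := tendsto_tsum_thetaLFunction_one N M 1 (-((Real.sqrt N : ℂ) * I)) (classInd M c)
    (classInd_periodic M c)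
  -- rescale `t = y / M²`
  have ht : Tendsto (fun y : ℝ ↦ y / (M : ℝ) ^ 2) (𝓝[>] 0) (𝓝[>] 0) :=
    tendsto_div_const_nhdsGT_zero (by positivity)
  have h := (hL.comp ht).const_mul (M : ℂ)
  refine h.congr' ?_
  filter_upwards [self_mem_nhdsWithin] with y (hy : 0 < y)
  simp only [Function.comp_apply]
  have hty : 0 < y / (M : ℝ) ^ 2 := by positivity
  have key := tsum_dampedTerm_eq N M c hty
  simp only [dampedTerm] at key
  rw [key, ← mul_assoc, mul_inv_cancel₀ hMc, one_mul]
  congr 1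
  field_simp

/-! ### The Kronecker limit formula on `Λ_N` and the Eisenstein numbers at division points -/

omit [NeZero N] in
/-- `divPoint 2 (1, 0) = 1/2`. [folklore] -/
theorem divPoint_two_one_zero : divPoint N 2 (1, 0) = 1 / 2 := by
  simp [divPoint, ZMod.val_one]

omit [NeZero N] in
/-- `divPoint 2 (0, 1) = τ_N/2`. [folklore] -/
theorem divPoint_two_zero_one : divPoint N 2 (0, 1) = (Real.sqrt N : ℂ) * I / 2 := by
  simp [divPoint, ZMod.val_one]

/-- **Kronecker's limit formula of weight one on `Λ_N = ℤ√-N + ℤ`** (Rubin, LNM 1716, Prop. 7.12,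
`k = 1`, in Gauss-damped form): for every `z ∈ ℂ`,

  `lim_{y → 0⁺} ∑_{l ∈ Λ_N} e^{-y|z-l|²}/(z - l) = E₁(z; Λ_N) = ζ(z; Λ_N) - η(z; Λ_N)`,

from the abstract `PeriodPair.tendsto_kroneckerSum_of_tendsto₂` with the Gaussian-sum bound
`gaussN_bound` and the convergence at the two division points `1/2`, `τ_N/2`
(`tendsto_kroneckerSum_divPoint`). [cite: Rubin1999, §7.4 Prop. 7.12 (LNM 1716 p. 244)] -/
theorem tendsto_kroneckerSum (z : ℂ) :
    Tendsto (fun y : ℝ ↦ (periodPair N).kroneckerSum y z) (𝓝[>] 0)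
      (𝓝 ((periodPair N).eisensteinE₁ z)) := by
  have hsN := sqrt_pos N
  have h₁ := tendsto_kroneckerSum_divPoint N 2 (1, 0)
  have h₂ := tendsto_kroneckerSum_divPoint N 2 (0, 1)
  rw [divPoint_two_one_zero] at h₁
  rw [divPoint_two_zero_one] at h₂
  have hD : (1 / 2 : ℂ) * conj ((Real.sqrt N : ℂ) * I / 2) -
      (Real.sqrt N : ℂ) * I / 2 * conj (1 / 2 : ℂ) ≠ 0 := by
    rw [map_div₀, conj_tau]
    have h2 : conj (2 : ℂ) = 2 := map_ofNat _ 2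
    rw [h2, map_div₀, map_one, h2]
    intro h
    have h' : (Real.sqrt N : ℂ) * I = 0 := by linear_combination (-2 : ℂ) * h
    rw [mul_eq_zero, Complex.ofReal_eq_zero] at h'
    rcases h' with h' | h'
    · exact hsN.ne' h'
    · exact I_ne_zero h'
  exact (periodPair N).tendsto_kroneckerSum_of_tendsto₂ (gaussN_bound N) hD h₁ h₂ z

set_option maxHeartbeats 800000 in
/-- **Eisenstein numbers at division points are weight-one theta `L`-values at `s = 1`**
(Rubin, LNM 1716, Prop. 7.15 at `k = 1` in character-free form): for every class `c` modulo `M`,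

  `M · thetaLFunction N M 1 (-τ_N) 𝟙_c 1 = E₁((c₁ + c₂ τ_N)/M; Λ_N)`,

i.e. the value at `s = 1` of the entire continuation of `∑_{y ≡ c (M)} (y₁ - y₂τ_N)(y₁² + Ny₂²)^{-s}
= M^{1-2s}… ∑_{β ∈ z + Λ_N} β̄ |β|^{-2s}` is `M⁻¹ E₁(z; Λ_N)`, `z = divPoint c`.
[cite: Rubin1999, §7.4 Prop. 7.12 and Prop. 7.15 (LNM 1716 pp. 244–245)] -/
theorem thetaLFunction_classInd_one (c : ZMod M × ZMod M) :
    (M : ℂ) * thetaLFunction N M 1 (-((Real.sqrt N : ℂ) * I)) (classInd M c) 1 =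
      (periodPair N).eisensteinE₁ (divPoint N M c) :=
  tendsto_nhds_unique (tendsto_kroneckerSum_divPoint N M c) (tendsto_kroneckerSum N (divPoint N M c))

/-! ### The finite formula for a periodic coefficient -/

omit [NeZero M] in
/-- The damped class family is summable for `t > 0` (`‖dampedTerm c t y‖ ≤ (1 + |τ_N|) e^{-tQ(y)}`).
[folklore] -/
theorem summable_dampedTerm (c : ZMod M × ZMod M) {t : ℝ} (ht : 0 < t) :
    Summable (dampedTerm N M c t) := by
  refine Summable.of_norm_bounded
    ((summable_exp_neg_mul_qf N ht).mul_left (1 + ‖(Real.sqrt N : ℂ) * I‖)) fun y ↦ ?_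
  rw [dampedTerm, norm_mul, Complex.norm_real, Real.norm_eq_abs, abs_of_pos (Real.exp_pos _)]
  refine mul_le_mul_of_nonneg_right ?_ (Real.exp_pos _).le
  rw [norm_div, norm_mul]
  have hind : ‖classInd M c y‖ ≤ 1 := by
    unfold classInd; split_ifs <;> simp
  rcases eq_or_ne y 0 with rfl | hy
  · simp [wt]
    positivity
  · have hQ1 : (1 : ℝ) ≤ ((qf N y : ℤ) : ℝ) := one_le_qf (N := N) hy
    have hQ : (0 : ℝ) < ((qf N y : ℤ) : ℝ) := by linarith
    have hQc : ‖(((qf N y : ℤ) : ℂ))‖ = ((qf N y : ℤ) : ℝ) := by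
      rw [← Complex.ofReal_intCast, Complex.norm_real, Real.norm_eq_abs, abs_of_pos hQ]
    have hw : ‖wt 1 (-((Real.sqrt N : ℂ) * I)) y‖ ≤
        (1 + ‖(Real.sqrt N : ℂ) * I‖) * ((qf N y : ℤ) : ℝ) := by
      calc ‖wt 1 (-((Real.sqrt N : ℂ) * I)) y‖
          ≤ (‖(1 : ℂ)‖ + ‖-((Real.sqrt N : ℂ) * I)‖) * (((qf N y : ℤ) : ℝ)) ^ (1 / 2 : ℝ) :=
            norm_wt_le N 1 _ y
        _ ≤ (‖(1 : ℂ)‖ + ‖-((Real.sqrt N : ℂ) * I)‖) * (((qf N y : ℤ) : ℝ)) ^ (1 : ℝ) :=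
            mul_le_mul_of_nonneg_left (Real.rpow_le_rpow_of_exponent_le hQ1 (by norm_num))
              (by positivity)
        _ = (1 + ‖(Real.sqrt N : ℂ) * I‖) * ((qf N y : ℤ) : ℝ) := by
            rw [Real.rpow_one, norm_one, norm_neg]
    rw [hQc, div_le_iff₀ hQ]
    calc ‖classInd M c y‖ * ‖wt 1 (-((Real.sqrt N : ℂ) * I)) y‖
        ≤ 1 * ((1 + ‖(Real.sqrt N : ℂ) * I‖) * ((qf N y : ℤ) : ℝ)) :=
          mul_le_mul hind hw (norm_nonneg _) zero_le_one
      _ = (1 + ‖(Real.sqrt N : ℂ) * I‖) * ((qf N y : ℤ) : ℝ) := one_mul _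

/-- **Splitting the damped sum of a periodic coefficient into classes**: for `t > 0`,
`∑_y Ψ(y) w(y) Q(y)⁻¹ e^{-tQ(y)} = ∑_{c mod M} Ψ(c) ∑_y dampedTerm c t y`. [folklore] -/
theorem hasSum_damped_of_periodic (Ψ : ℤ × ℤ → ℂ)
    (hΨ : ∀ y z : ℤ × ℤ, Ψ (y.1 + M * z.1, y.2 + M * z.2) = Ψ y) {t : ℝ} (ht : 0 < t) :
    HasSum (fun y : ℤ × ℤ ↦ Ψ y * wt 1 (-((Real.sqrt N : ℂ) * I)) y / ((qf N y : ℤ) : ℂ) *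
        ((rexp (-t * ((qf N y : ℤ) : ℝ)) : ℝ) : ℂ))
      (∑ c : ZMod M × ZMod M, Ψ (rep M c 0) * ∑' y : ℤ × ℤ, dampedTerm N M c t y) := by
  classical
  have key : ∀ c : ZMod M × ZMod M,
      HasSum (fun y : ℤ × ℤ ↦ if cls M y = c then Ψ y * wt 1 (-((Real.sqrt N : ℂ) * I)) y /
          ((qf N y : ℤ) : ℂ) * ((rexp (-t * ((qf N y : ℤ) : ℝ)) : ℝ) : ℂ) else 0)
        (Ψ (rep M c 0) * ∑' y : ℤ × ℤ, dampedTerm N M c t y) := by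
    intro c
    have h1 : HasSum (fun y : ℤ × ℤ ↦ Ψ (rep M c 0) * dampedTerm N M c t y)
        (Ψ (rep M c 0) * ∑' y : ℤ × ℤ, dampedTerm N M c t y) :=
      (summable_dampedTerm N M c ht).hasSum.mul_left (Ψ (rep M c 0))
    refine h1.congr_fun fun y ↦ ?_
    by_cases hyc : cls M y = c
    · obtain ⟨w, hw⟩ := exists_rep_eq M hyc
      have hΨy : Ψ y = Ψ (rep M c 0) := by
        rw [← hw, rep_eq_rep_zero_add M c w, hΨ]
      rw [if_pos hyc, dampedTerm, classInd, if_pos hyc, hΨy]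
      ring
    · rw [if_neg hyc, dampedTerm, classInd, if_neg hyc]
      ring
  have h := hasSum_sum (s := (Finset.univ : Finset (ZMod M × ZMod M))) fun c _ ↦ key c
  refine h.congr_fun fun y ↦ ?_
  simp only [Finset.sum_ite_eq, Finset.mem_univ, if_true]

/-- **The finite formula**: for `Ψ : ℤ × ℤ → ℂ` periodic modulo `M`,
`thetaLFunction N M 1 (-τ_N) Ψ 1 = M⁻¹ ∑_{c mod M} Ψ(c) E₁(divPoint c; Λ_N)` — weight-one Hecke-type
`L`-values of the form `∑ Ψ(y)(y₁ - y₂τ_N)(y₁² + Ny₂²)^{-s}` at `s = 1` as Eisenstein numbers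
(Rubin, LNM 1716, Prop. 7.15 at `k = 1`; for `N = 1` cf.
`GaussianLatticeHeckeLValue.thetaLFunction_one_eq_sum_kroneckerE₁`).
[cite: Rubin1999, §7.4 Prop. 7.15 (LNM 1716 p. 245)] -/
theorem thetaLFunction_one_eq_sum_eisensteinE₁ (Ψ : ℤ × ℤ → ℂ)
    (hΨ : ∀ y z : ℤ × ℤ, Ψ (y.1 + M * z.1, y.2 + M * z.2) = Ψ y) :
    thetaLFunction N M 1 (-((Real.sqrt N : ℂ) * I)) Ψ 1 =
      (M : ℂ)⁻¹ * ∑ c : ZMod M × ZMod M,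
        Ψ (rep M c 0) * (periodPair N).eisensteinE₁ (divPoint N M c) := by
  have hMc : (M : ℂ) ≠ 0 := Nat.cast_ne_zero.mpr (NeZero.ne M)
  -- the damped sums for `Ψ` tend to the `L`-value …
  have hL := tendsto_tsum_thetaLFunction_one N M 1 (-((Real.sqrt N : ℂ) * I)) Ψ hΨ
  -- … and, class by class, to the class `L`-values
  have hc : ∀ c : ZMod M × ZMod M, Tendsto (fun t : ℝ ↦ ∑' y : ℤ × ℤ, dampedTerm N M c t y)
      (𝓝[>] 0) (𝓝 (thetaLFunction N M 1 (-((Real.sqrt N : ℂ) * I)) (classInd M c) 1)) := fun c ↦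
    tendsto_tsum_thetaLFunction_one N M 1 (-((Real.sqrt N : ℂ) * I)) (classInd M c)
      (classInd_periodic M c)
  have hE : Tendsto (fun t : ℝ ↦ ∑' y : ℤ × ℤ, Ψ y * wt 1 (-((Real.sqrt N : ℂ) * I)) y /
      ((qf N y : ℤ) : ℂ) * ((rexp (-t * ((qf N y : ℤ) : ℝ)) : ℝ) : ℂ)) (𝓝[>] 0)
      (𝓝 (∑ c : ZMod M × ZMod M, Ψ (rep M c 0) *
        thetaLFunction N M 1 (-((Real.sqrt N : ℂ) * I)) (classInd M c) 1)) := by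
    refine (tendsto_finsetSum _ fun c _ ↦ (hc c).const_mul (Ψ (rep M c 0))).congr' ?_
    filter_upwards [self_mem_nhdsWithin] with t (ht : 0 < t)
    exact ((hasSum_damped_of_periodic N M Ψ hΨ ht).tsum_eq).symm
  have heq := tendsto_nhds_unique hL hE
  rw [heq, Finset.mul_sum]
  refine Finset.sum_congr rfl fun c _ ↦ ?_
  rw [← thetaLFunction_classInd_one N M c]
  field_simp

end BinaryLattice

end Literature.NumberTheory.EllipticCurves

end
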